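import Literature.NumberTheory.LFunctions.ChebotarevCyclicCount
import HarnessLib

/-!
# Elements of order divisible by `n` in a coset of a subgroup of a cyclic group

Topic `Literature/NumberTheory/LFunctions`; namespace `Literature.NumberTheory.LFunctions.Chebotarev`.
Everything in this file is PROVED (theorems only); it is the coset form of
`ChebotarevCyclicCount.lean` (`le_card_filter_dvd_orderOf`: in a finite cyclic group `W` with
`nᵏ ∣ #W` at least `(1 - n/2ᵏ) · #W` elements have order divisible by `n`).

In Chebotarev's proof of his density theorem (Stevenhagen–Lenstra, *Chebotarëv and his density
theorem*, 1996, "Chebotarëv's proof"; the tree's `GaloisRepresentations/ChebotarevCyclicProofs.lean`,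
step 3, for the existence of *one* such element) the auxiliary elements are the lifts `h` of a
fixed `σ ∈ Gal(L/K)` to `Gal(L(ζ_ℓ)/K)` whose cyclotomic character `χ(h) ∈ (ℤ/ℓ)ˣ` has order
divisible by `n = ord σ`; the values `χ(h)` form a **coset** `a₀ · χ(Gal(L(ζ_ℓ)/L))` of a subgroup
of the cyclic group `(ℤ/ℓ)ˣ`.  We prove the counting statement for cosets:

* `card_filter_coset_pow_eq_one_le` — for a subgroup `W` of a commutative group `C`, an
  element `a₀` and an exponent `e`, the number of `w ∈ W` with `(a₀ w)ᵉ = 1` is at most the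
  number of `u ∈ W` with `uᵉ = 1` (if `a₀ w₀` is one solution, `w ↦ w₀⁻¹ w` maps solutions
  injectively to solutions in `W`);
* **`le_card_filter_dvd_orderOf_coset`** — if `C` is a finite cyclic group, `W ≤ C` with
  `nᵏ ∣ #W` (`n, k ≥ 1`) and `a₀ ∈ C`, then at least `(1 - n/2ᵏ) · #W` elements `w ∈ W` have
  `n ∣ ord (a₀ w)`.

## References

* P. Stevenhagen, H. W. Lenstra, *Chebotarëv and his density theorem*, Math. Intelligencer 18
  (1996), no. 2, 26–37. [StevenhagenLenstra1996]
-/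

noncomputable section

open scoped Classical

namespace Literature.NumberTheory.LFunctions.Chebotarev

variable {C : Type*} [CommGroup C] [Fintype C]

/-- In a commutative group, for a subgroup `W`, `a₀ ∈ C` and an exponent `e`:
`#{w ∈ W : (a₀ w)ᵉ = 1} ≤ #{u ∈ W : uᵉ = 1}` (if `a₀ w₀` is a solution then `w ↦ w₀⁻¹ w` is an
injection into the solutions in `W`, as `(w₀⁻¹ w)ᵉ = (a₀ w₀)⁻ᵉ (a₀ w)ᵉ`). [folklore] -/
theorem card_filter_coset_pow_eq_one_le (W : Subgroup C) (a₀ : C) (e : ℕ) :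
    (Finset.univ.filter fun w : W ↦ (a₀ * (w : C)) ^ e = 1).card ≤
      (Finset.univ.filter fun u : W ↦ (u : C) ^ e = 1).card := by
  by_cases hne : (Finset.univ.filter fun w : W ↦ (a₀ * (w : C)) ^ e = 1).Nonempty
  · obtain ⟨w₀, hw₀⟩ := hne
    rw [Finset.mem_filter] at hw₀
    refine Finset.card_le_card_of_injOn (fun w ↦ w₀⁻¹ * w) (fun w hw ↦ ?_) ?_
    · rw [Finset.mem_coe, Finset.mem_filter] at hw ⊢
      refine ⟨Finset.mem_univ _, ?_⟩
      have h1 := hw.2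
      have h0 := hw₀.2
      rw [Subgroup.coe_mul, Subgroup.coe_inv]
      calc ((w₀ : C)⁻¹ * (w : C)) ^ e = ((a₀ * (w₀ : C))⁻¹ * (a₀ * (w : C))) ^ e := by
            congr 1; group
        _ = 1 := by rw [mul_pow, inv_pow, h0, h1, inv_one, one_mul]
    · intro w _ w' _ h
      exact mul_left_cancel h
  · rw [Finset.not_nonempty_iff_eq_empty] at hne
    rw [hne, Finset.card_empty]
    exact Nat.zero_le _

variable [IsCyclic C]

/-- **Coset form of the count.** Let `C` be a finite cyclic group, `W ≤ C` a subgroup with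
`nᵏ ∣ #W` (`n, k ≥ 1`), and `a₀ ∈ C`.  Then at least `(1 - n/2ᵏ) · #W` elements `w ∈ W` have
`n ∣ ord(a₀ w)`: an element `x = a₀ w` with `n ∤ ord x` has `ℓᵇ ∤ ord x` for some exact prime
power `ℓᵇ ∥ n` and then `xᵉ = 1`, `e = ℓ^{b-1} · N'` (`N'` the prime-to-`ℓ` part of `#C`,
`pow_eq_one_of_not_pow_dvd_orderOf`); by `card_filter_coset_pow_eq_one_le` there are at most
`#{u ∈ W : uᵉ = 1}` such `w` for each `ℓ`, and `uᵉ = 1` forces `ℓᵇ ∤ ord u`, of which `W` has at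
most `#W / 2ᵏ` (`card_filter_not_pow_dvd_orderOf_le` in the cyclic group `W`).
[cite: StevenhagenLenstra1996, §"Chebotarëv's proof"] -/
theorem le_card_filter_dvd_orderOf_coset (W : Subgroup C) {n k : ℕ} (hn : 0 < n) (hk0 : 0 < k)
    (hk : n ^ k ∣ Nat.card W) (a₀ : C) :
    (1 - (n : ℝ) / 2 ^ k) * Nat.card W ≤
      ((Finset.univ.filter fun w : W ↦ n ∣ orderOf (a₀ * (w : C))).card : ℝ) := by
  have hW0 : Nat.card W ≠ 0 := Nat.card_pos.ne'
  have hcardW : Fintype.card W = Nat.card W := Fintype.card_eq_nat_card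
  -- the bad set is covered by the sets `(a₀ w)^{e_ℓ} = 1`, `ℓ ∣ n`
  set e : ℕ → ℕ := fun ℓ ↦ ℓ ^ (n.factorization ℓ - 1) * ordCompl[ℓ] (Fintype.card C) with he
  have hsub : (Finset.univ.filter fun w : W ↦ ¬ n ∣ orderOf (a₀ * (w : C))) ⊆
      n.primeFactors.biUnion fun ℓ ↦
        Finset.univ.filter fun w : W ↦ (a₀ * (w : C)) ^ e ℓ = 1 := by
    intro w hw
    simp only [Finset.mem_filter, Finset.mem_univ, true_and] at hw
    rw [Nat.dvd_iff_prime_pow_dvd_dvd] at hw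
    simp only [not_forall] at hw
    obtain ⟨ℓ, j, hℓ, hjn, hjx⟩ := hw
    have hj0 : j ≠ 0 := by
      rintro rfl
      exact hjx (by simp)
    have hℓn : ℓ ∣ n := (dvd_pow_self ℓ hj0).trans hjn
    simp only [Finset.mem_biUnion, Nat.mem_primeFactors, Finset.mem_filter, Finset.mem_univ,
      true_and]
    refine ⟨ℓ, ⟨hℓ, hℓn, hn.ne'⟩, ?_⟩
    refine pow_eq_one_of_not_pow_dvd_orderOf hℓ _ fun h ↦ hjx ?_
    have hjle : j ≤ n.factorization ℓ :=
      (Nat.Prime.pow_dvd_iff_le_factorization hℓ hn.ne').mp hjn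
    exact (Nat.pow_dvd_pow ℓ hjle).trans h
  -- each piece has at most `#W / 2^k` elements
  have hpiece : ∀ ℓ ∈ n.primeFactors,
      ((Finset.univ.filter fun w : W ↦ (a₀ * (w : C)) ^ e ℓ = 1).card : ℝ) ≤
        (Nat.card W : ℝ) / 2 ^ k := by
    intro ℓ hℓ
    rw [Nat.mem_primeFactors] at hℓ
    obtain ⟨hℓp, hℓn, -⟩ := hℓ
    set b := n.factorization ℓ with hb
    have hb0 : 0 < b := Nat.Prime.factorization_pos_of_dvd hℓp hn.ne' hℓn
    -- `#{w : (a₀ w)^e = 1} ≤ #{u ∈ W : u^e = 1} ≤ #{u ∈ W : ℓ^b ∤ ord u} ≤ #W / 2^k`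
    have h1 := card_filter_coset_pow_eq_one_le W a₀ (e ℓ)
    have h2 : (Finset.univ.filter fun u : W ↦ (u : C) ^ e ℓ = 1) ⊆
        (Finset.univ.filter fun u : W ↦ ¬ ℓ ^ b ∣ orderOf u) := by
      intro u hu
      simp only [Finset.mem_filter, Finset.mem_univ, true_and] at hu ⊢
      intro hdvd
      -- `ord u ∣ e = ℓ^{b-1} N'` with `ℓ ∤ N'` contradicts `ℓ^b ∣ ord u`
      have hord : orderOf u ∣ e ℓ := by
        rw [← Subgroup.orderOf_coe]
        exact orderOf_dvd_of_pow_eq_one hu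
      have hcop : Nat.Coprime ℓ (ordCompl[ℓ] (Fintype.card C)) :=
        Nat.coprime_ordCompl hℓp Fintype.card_ne_zero
      have h3 : ℓ ^ b ∣ ℓ ^ (b - 1) * ordCompl[ℓ] (Fintype.card C) := hdvd.trans hord
      have h4 : ℓ ^ b ∣ ℓ ^ (b - 1) :=
        ((Nat.Coprime.pow_left b hcop).dvd_of_dvd_mul_right h3)
      have h5 := Nat.le_of_dvd (pow_pos hℓp.pos _) h4
      have h6 : ℓ ^ (b - 1) < ℓ ^ b := Nat.pow_lt_pow_right hℓp.one_lt (by omega)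
      omega
    have h3 : ((Finset.univ.filter fun u : W ↦ ¬ ℓ ^ b ∣ orderOf u).card : ℝ) ≤
        (Fintype.card W : ℝ) / 2 ^ k := by
      refine card_filter_not_pow_dvd_orderOf_le (G := W) hℓp hb0 hk0 ?_
      rw [hcardW]
      have := (Nat.factorization_le_iff_dvd (pow_ne_zero k hn.ne') hW0).mpr hk
      have hkl := this ℓ
      rw [Nat.factorization_pow] at hkl
      simpa [mul_comm] using hkl
    rw [hcardW] at h3
    calc ((Finset.univ.filter fun w : W ↦ (a₀ * (w : C)) ^ e ℓ = 1).card : ℝ)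
        ≤ ((Finset.univ.filter fun u : W ↦ (u : C) ^ e ℓ = 1).card : ℝ) := by exact_mod_cast h1
      _ ≤ ((Finset.univ.filter fun u : W ↦ ¬ ℓ ^ b ∣ orderOf u).card : ℝ) := by
          exact_mod_cast Finset.card_le_card h2
      _ ≤ (Nat.card W : ℝ) / 2 ^ k := h3
  -- the bad elements are at most `n · #W / 2^k`
  have hnfac : n.primeFactors.card ≤ n :=
    (Finset.card_le_card fun ℓ hℓ ↦
      Nat.mem_divisors.mpr ⟨Nat.dvd_of_mem_primeFactors hℓ, hn.ne'⟩).trans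
      (Nat.card_divisors_le_self n)
  have hbad : ((Finset.univ.filter fun w : W ↦ ¬ n ∣ orderOf (a₀ * (w : C))).card : ℝ) ≤
      n * ((Nat.card W : ℝ) / 2 ^ k) := by
    calc ((Finset.univ.filter fun w : W ↦ ¬ n ∣ orderOf (a₀ * (w : C))).card : ℝ)
        ≤ ((n.primeFactors.biUnion fun ℓ ↦
            Finset.univ.filter fun w : W ↦ (a₀ * (w : C)) ^ e ℓ = 1).card : ℝ) := by
          exact_mod_cast Finset.card_le_card hsub
      _ ≤ ∑ ℓ ∈ n.primeFactors,
            ((Finset.univ.filter fun w : W ↦ (a₀ * (w : C)) ^ e ℓ = 1).card : ℝ) := by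
          exact_mod_cast Finset.card_biUnion_le
      _ ≤ ∑ ℓ ∈ n.primeFactors, (Nat.card W : ℝ) / 2 ^ k := Finset.sum_le_sum hpiece
      _ = n.primeFactors.card * ((Nat.card W : ℝ) / 2 ^ k) := by
          rw [Finset.sum_const, nsmul_eq_mul]
      _ ≤ n * ((Nat.card W : ℝ) / 2 ^ k) :=
          mul_le_mul_of_nonneg_right (by exact_mod_cast hnfac) (by positivity)
  -- conclude
  have hsplit : (Finset.univ.filter fun w : W ↦ n ∣ orderOf (a₀ * (w : C))).card +
      (Finset.univ.filter fun w : W ↦ ¬ n ∣ orderOf (a₀ * (w : C))).card = Nat.card W := by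
    rw [Finset.card_filter_add_card_filter_not, Finset.card_univ, hcardW]
  have hcast : ((Finset.univ.filter fun w : W ↦ n ∣ orderOf (a₀ * (w : C))).card : ℝ) =
      Nat.card W - ((Finset.univ.filter fun w : W ↦ ¬ n ∣ orderOf (a₀ * (w : C))).card : ℝ) := by
    rw [eq_sub_iff_add_eq]
    exact_mod_cast hsplit
  rw [hcast]
  have hring : (n : ℝ) * ((Nat.card W : ℝ) / 2 ^ k) = (n : ℝ) / 2 ^ k * (Nat.card W : ℝ) := by
    ring
  rw [hring] at hbad
  nlinarith [hbad]

end Literature.NumberTheory.LFunctions.Chebotarev
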